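import Mathlib
import HarnessLib
import Summits.HubbardSuperconductivity.HubbardSuperconductivity.Theorems.KLProgrammeKLRegimeEngineV8DefsU12bG
import Summits.HubbardSuperconductivity.HubbardSuperconductivity.Theorems.KLProgrammeKLRegimeEngineV8TowerCoreDefsCGU
import Summits.HubbardSuperconductivity.HubbardSuperconductivity.Theorems.KLProgrammeKLRegimeEngineV8DefsValU
import Summits.HubbardSuperconductivity.HubbardSuperconductivity.Theorems.KLProgrammeKLRegimeEngineV8PairTransferExport8
import Summits.HubbardSuperconductivity.HubbardSuperconductivity.Theorems.KLProgrammeKLRegimeEngineV8TwoLegSpaceMomentsExportZ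

/-!
# K3 ENGINE package, U-level v12b and token #28 AT A GEOMETRY SLOT `G` AND A PACKAGE SLOT `Q` — registrant PRESTAGE for the option of folding the token-#13 motion (α1)
# «(ℓ)-CE-CAP» into «A24∪A25» (plan g24 (R269)(C): G := `klEngGeo14` elect; word asked of p1b); cell gate-hubbard-kl, seat gate-hubbard-kl-p1b g16 (20437 v2 registrant lineage)

WHY.  D3G (`…DefsU12bG`, p664965) re-keys token #14 at a geometry slot but keeps the frozen package token `klEngQ9c P R` in its Q-keyed entries (`klIsoMomU G P R (klEngQ9c P R) cc`,
`klCTu7 … (klEngQ9c P R) cc`, `klZspU5 … (klEngQ9c P R) cc`, `klGridLitUAtG G P R (klEngQ9c P R) cc`, `klTowerCoreUC9G G P R (klEngQ9c P R) cc`, and through the frozen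
`klEngU₀12`: `klCUu2 P R (klEngQ7 P R) (klEngQ9c P R) cc`, `klE5ShareU2 P R (klEngQ9c P R) cc`, `klTowerU/klTowerUC P R (klEngQ9c P R) cc`).  A token-#13 motion
(`klEngQ9c ↦ Q'`, e.g. `Q' := klEngQ9dG klEngGeo14 P R` of `…DefsQ9dG`) needs the SAME entries at `Q'`, and the (α1) cure reads the UNCAPPED core package's thresholds
(`klTowerCoreUCG / klTowerCoreCCG`, …TowerCoreDefsCGU) instead of the capped ones.  Every Q-keyed entry is already a FUNCTION of the package, so this file states the
chains ONCE with BOTH slots explicit: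
* §1 **`klEngU₀12GQ G Q P R cc := klEngU₀12G G P R cc ⊓ klCUu2 P R (klEngQ7 P R) Q cc ⊓ klE5ShareU2 P R Q cc ⊓ klTowerU P R Q cc ⊓ klTowerUC P R Q cc ⊓ klIsoMomU G P R Q cc
  ⊓ klE4UF G P R Q cc ⊓ klCTu7 P R (klEngQ7 P R) G klEngGeoTh Q cc ⊓ klE5RowsUG G P Q ⊓ klZspU5 P R (klEngQ7 P R) G Q cc ⊓ klGridLitUAtG G P R Q cc ⊓ klTowerCoreUCG G P R Q cc
  ⊓ klCTu8T P R (klEngQ7 P R) G klEngGeoTh Q cc ⊓ klZspU5Z P R (klEngQ7 P R) G Q cc ⊓ klValU P Q`** (the A25 «KLTS-CAP» bundled u-slot of …PairTransferExport8, the «Z-LAW» layer's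
  threshold of …TwoLegSpaceMomentsExportZ, and the located door «(c)-HCU-QCR» …DefsValU LAST),
  one `klEngU₀12GQ_le_<entry>` row per entry (named as §C / the closers read them), `klEngU₀12GQ_le_klEngU₀12G` and through it every (G-keyed or G-free) D3G/D3″ row by name
  (`_le_klEngU₀10` — THE #14 LIFT LINE —, `_le_klTwoLegMomU`, `_le_inv_klZs2G`, `_le_cz_klZs1G`, `_le_inv_klZs1G`, `_le_klE5FrU`, `_le_klTSU`, `_le_klLastRespU`, `_le_klGridU₀`,
  `_le_inv_klReadOscC`, `_le_klTailBookU`, `_le_klE5uM`, `_le_klEngU₀9`, `_le_klEngU₀3`), **`klEngU₀12GQ_pos Q P cc hG hP hR hQ`** (`hQ : 0 ≤ Q.CR`, for `klValU_pos`);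
* §2 **`klEngC₃7GU G P R := klEngC₃7G G P R ⊓ klTowerCoreCCG G P R`** (token #28 at G with the UNCAPPED core's c-threshold added; Q-free), rows `_le_klEngC₃7G` and through it
  `_le_klEngC₃6 / _le_cz_row / _le_log_row / _le_klTowerCC / _le_klTowerCoreCC9G / _le_klGridLitCAtG`, `_le_klTowerCoreCCG`, `klEngC₃7GU_pos G P hR`, `klZs1G_mixedRow_of_doorsU`.
Image use under «A24∪A25∪α1»: `U ≤ klEngU₀12GQ klEngGeo14 (klEngQ9dG klEngGeo14 P R) P R c`, `c ≤ klEngC₃7GU klEngGeo14 P R`.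
NOT A MOTION: nothing registers, no token of record moves.  Definitions with bodies + order lemmas; nothing about the model is asserted; nothing asserts any stub of 20437,
K3 or superconductivity.
-/

noncomputable section

namespace Summit.HubbardSuperconductivity.HubbardSuperconductivity.Theorems.EngineV8

set_option linter.dupNamespace false -- summit = problem name (single-conjunct summit), D-0017

open Real Finset Literature.MathematicalPhysics.QuantumLattice Literature.Probability.LatticeModels
open Summit.HubbardSuperconductivity.HubbardSuperconductivity.Theorems.KLRegimeSplit
open Summit.HubbardSuperconductivity.HubbardSuperconductivity.Theorems.KLProgrammeLegKernels
open Summit.HubbardSuperconductivity.HubbardSuperconductivity.Theorems.DispersionFlow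

/-! ## §1 Token #14 at the slots `(G, Q)` -/

/-- **`klEngU₀12GQ G Q P R cc`** — token #14 re-keyed at a geometry slot `G` AND a package slot `Q`: D3G's `klEngU₀12G G P R cc` (all frozen and G-keyed-at-`klEngQ9c`
entries kept) capped by the Q-keyed entries AT `Q` — class #1 `klCUu2 … Q`, class #3 `klE5ShareU2 … Q`, E1's v1/c-slotted full towers `klTowerU / klTowerUC … Q`, class #6
`klIsoMomU G P R Q`, class #4 `klE4UF G P R Q`, class #5 `klCTu7 … G klEngGeoTh Q`, (c)-E5 rows `klE5RowsUG G P Q`, #17 `klZspU5 … G Q`, the grid producer `klGridLitUAtG G P R Q`,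
the UNCAPPED core-C threshold `klTowerCoreUCG G P R Q`, the A25 cap′-package's bundled u-slot `klCTu8T … G klEngGeoTh Q`, the Z-layer's `klZspU5Z … G Q`, and the (c) value
lane's `Q.CR`-keyed door `klValU P Q` («(c)-HCU-QCR», …DefsValU) LAST. -/
def klEngU₀12GQ (G : GeoConsts) (Q : EngConsts) (P : SplitConsts) (R : RenConsts) (cc : ℝ) : ℝ :=
  min (klEngU₀12G G P R cc)
    (min (klCUu2 P R (klEngQ7 P R) Q cc)
      (min (klE5ShareU2 P R Q cc)
        (min (klTowerU P R Q cc)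
          (min (klTowerUC P R Q cc)
            (min (klIsoMomU G P R Q cc)
              (min (klE4UF G P R Q cc)
                (min (klCTu7 P R (klEngQ7 P R) G klEngGeoTh Q cc)
                  (min (klE5RowsUG G P Q)
                    (min (klZspU5 P R (klEngQ7 P R) G Q cc)
                      (min (klGridLitUAtG G P R Q cc) (min (klTowerCoreUCG G P R Q cc)
                        (min (klCTu8T P R (klEngQ7 P R) G klEngGeoTh Q cc) (min (klZspU5Z P R (klEngQ7 P R) G Q cc) (klValU P Q))))))))))))))

section Projections

variable (G : GeoConsts) (Q : EngConsts) (P : SplitConsts) (R : RenConsts) (cc : ℝ)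

/-- `klEngU₀12GQ G Q P R cc ≤ klEngU₀12G G P R cc` — every D3G door is kept. -/
theorem klEngU₀12GQ_le_klEngU₀12G : klEngU₀12GQ G Q P R cc ≤ klEngU₀12G G P R cc := min_le_left _ _

/-- `klEngU₀12GQ ≤ klCUu2 P R (klEngQ7 P R) Q cc` (class #1 at `Q`; §C's unroll row). -/
theorem klEngU₀12GQ_le_klCUu2 : klEngU₀12GQ G Q P R cc ≤ klCUu2 P R (klEngQ7 P R) Q cc := (min_le_right _ _).trans (min_le_left _ _)

/-- `klEngU₀12GQ ≤ klE5ShareU2 P R Q cc` (class #3 at `Q`). -/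
theorem klEngU₀12GQ_le_klE5ShareU2 : klEngU₀12GQ G Q P R cc ≤ klE5ShareU2 P R Q cc :=
  (min_le_right _ _).trans ((min_le_right _ _).trans (min_le_left _ _))

/-- `klEngU₀12GQ ≤ klTowerU P R Q cc` (E1's v1 full tower at `Q`). -/
theorem klEngU₀12GQ_le_klTowerU : klEngU₀12GQ G Q P R cc ≤ klTowerU P R Q cc :=
  (min_le_right _ _).trans ((min_le_right _ _).trans ((min_le_right _ _).trans (min_le_left _ _)))

/-- `klEngU₀12GQ ≤ klTowerUC P R Q cc` (D1's c-slotted full tower at `Q`). -/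
theorem klEngU₀12GQ_le_klTowerUC : klEngU₀12GQ G Q P R cc ≤ klTowerUC P R Q cc :=
  (min_le_right _ _).trans ((min_le_right _ _).trans ((min_le_right _ _).trans ((min_le_right _ _).trans (min_le_left _ _))))

/-- `klEngU₀12GQ ≤ klIsoMomU G P R Q cc` (class #6 moment package at `(G, Q)`; the (b) closer's row). -/
theorem klEngU₀12GQ_le_klIsoMomU : klEngU₀12GQ G Q P R cc ≤ klIsoMomU G P R Q cc :=
  (min_le_right _ _).trans ((min_le_right _ _).trans ((min_le_right _ _).trans ((min_le_right _ _).trans ((min_le_right _ _).trans (min_le_left _ _)))))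

/-- `klEngU₀12GQ ≤ klE4UF G P R Q cc` (class #4 at `(G, Q)`). -/
theorem klEngU₀12GQ_le_klE4UF : klEngU₀12GQ G Q P R cc ≤ klE4UF G P R Q cc :=
  (min_le_right _ _).trans ((min_le_right _ _).trans ((min_le_right _ _).trans ((min_le_right _ _).trans ((min_le_right _ _).trans ((min_le_right _ _).trans
    (min_le_left _ _))))))

/-- `klEngU₀12GQ ≤ klCTu7 P R (klEngQ7 P R) G klEngGeoTh Q cc` (class #5 at `(G, Q)`; §C row). -/
theorem klEngU₀12GQ_le_klCTu7 : klEngU₀12GQ G Q P R cc ≤ klCTu7 P R (klEngQ7 P R) G klEngGeoTh Q cc :=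
  (min_le_right _ _).trans ((min_le_right _ _).trans ((min_le_right _ _).trans ((min_le_right _ _).trans ((min_le_right _ _).trans ((min_le_right _ _).trans
    ((min_le_right _ _).trans (min_le_left _ _)))))))

/-- `klEngU₀12GQ ≤ klE5RowsUG G P Q` ((c)-E5 rows at `(G, Q)`). -/
theorem klEngU₀12GQ_le_klE5RowsUG : klEngU₀12GQ G Q P R cc ≤ klE5RowsUG G P Q :=
  (min_le_right _ _).trans ((min_le_right _ _).trans ((min_le_right _ _).trans ((min_le_right _ _).trans ((min_le_right _ _).trans ((min_le_right _ _).trans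
    ((min_le_right _ _).trans ((min_le_right _ _).trans (min_le_left _ _))))))))

/-- `klEngU₀12GQ ≤ klZspU5 P R (klEngQ7 P R) G Q cc` (#17 producer at `(G, Q)`; §C row). -/
theorem klEngU₀12GQ_le_klZspU5 : klEngU₀12GQ G Q P R cc ≤ klZspU5 P R (klEngQ7 P R) G Q cc :=
  (min_le_right _ _).trans ((min_le_right _ _).trans ((min_le_right _ _).trans ((min_le_right _ _).trans ((min_le_right _ _).trans ((min_le_right _ _).trans
    ((min_le_right _ _).trans ((min_le_right _ _).trans ((min_le_right _ _).trans (min_le_left _ _)))))))))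

/-- `klEngU₀12GQ ≤ klGridLitUAtG G P R Q cc` (grid producer at `(G, Q)`; the (b) closer's `hUu`). -/
theorem klEngU₀12GQ_le_klGridLitUAtG : klEngU₀12GQ G Q P R cc ≤ klGridLitUAtG G P R Q cc :=
  (min_le_right _ _).trans ((min_le_right _ _).trans ((min_le_right _ _).trans ((min_le_right _ _).trans ((min_le_right _ _).trans ((min_le_right _ _).trans
    ((min_le_right _ _).trans ((min_le_right _ _).trans ((min_le_right _ _).trans ((min_le_right _ _).trans (min_le_left _ _))))))))))

/-- `klEngU₀12GQ ≤ klTowerCoreUCG G P R Q cc` (the UNCAPPED core-C threshold at `(G, Q)`; the (α1) (b) closer feeds `towerCoreCG_at`'s `hUu`). -/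
theorem klEngU₀12GQ_le_klTowerCoreUCG : klEngU₀12GQ G Q P R cc ≤ klTowerCoreUCG G P R Q cc :=
  (min_le_right _ _).trans ((min_le_right _ _).trans ((min_le_right _ _).trans ((min_le_right _ _).trans ((min_le_right _ _).trans ((min_le_right _ _).trans ((min_le_right _ _).trans ((min_le_right _ _).trans ((min_le_right _ _).trans ((min_le_right _ _).trans ((min_le_right _ _).trans (min_le_left _ _)))))))))))

/-- `klEngU₀12GQ ≤ klValU P Q` (the (c) value lane's `Q.CR`-keyed door «(c)-HCU-QCR»; k3c2-p2 reads `hcU_of_le_klValU_wf hP hQ hU (hUle.trans (klEngU₀12GQ_le_klValU …))`). -/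
theorem klEngU₀12GQ_le_klValU : klEngU₀12GQ G Q P R cc ≤ klValU P Q :=
  (min_le_right _ _).trans ((min_le_right _ _).trans ((min_le_right _ _).trans ((min_le_right _ _).trans ((min_le_right _ _).trans ((min_le_right _ _).trans ((min_le_right _ _).trans ((min_le_right _ _).trans ((min_le_right _ _).trans ((min_le_right _ _).trans ((min_le_right _ _).trans ((min_le_right _ _).trans ((min_le_right _ _).trans (min_le_right _ _)))))))))))))

/-- `klEngU₀12GQ ≤ klCTu8T P R (klEngQ7 P R) G klEngGeoTh Q cc` («A25 (X).3-KLTS-CAP»: the cap′-package's bundled u-slot at `(G, Q)`; §C row for `pairTransferRelFamilyK5_klCT8_all_of_exists_T`). -/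
theorem klEngU₀12GQ_le_klCTu8T : klEngU₀12GQ G Q P R cc ≤ klCTu8T P R (klEngQ7 P R) G klEngGeoTh Q cc :=
  (min_le_right _ _).trans ((min_le_right _ _).trans ((min_le_right _ _).trans ((min_le_right _ _).trans ((min_le_right _ _).trans ((min_le_right _ _).trans ((min_le_right _ _).trans ((min_le_right _ _).trans ((min_le_right _ _).trans ((min_le_right _ _).trans ((min_le_right _ _).trans ((min_le_right _ _).trans (min_le_left _ _))))))))))))

/-- `klEngU₀12GQ ≤ klZspU5Z P R (klEngQ7 P R) G Q cc` («(C2)-Z-LAW» layer: #17's Z-deferred threshold at `(G, Q)`; §C row for `twoLegDualSpaceMomentsUpToAt_all_of_existsZ`). -/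
theorem klEngU₀12GQ_le_klZspU5Z : klEngU₀12GQ G Q P R cc ≤ klZspU5Z P R (klEngQ7 P R) G Q cc :=
  (min_le_right _ _).trans ((min_le_right _ _).trans ((min_le_right _ _).trans ((min_le_right _ _).trans ((min_le_right _ _).trans ((min_le_right _ _).trans ((min_le_right _ _).trans ((min_le_right _ _).trans ((min_le_right _ _).trans ((min_le_right _ _).trans ((min_le_right _ _).trans ((min_le_right _ _).trans ((min_le_right _ _).trans (min_le_left _ _)))))))))))))

/-! ### D3G / D3″ rows lifted through `klEngU₀12GQ_le_klEngU₀12G` (names = D3G's with `12G ↦ 12GQ`) -/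

/-- **THE #14 LIFT LINE at `(G, Q)`**: `klEngU₀12GQ ≤ klEngU₀10` (the image's `hU10`). -/
theorem klEngU₀12GQ_le_klEngU₀10 : klEngU₀12GQ G Q P R cc ≤ klEngU₀10 P R cc := (klEngU₀12GQ_le_klEngU₀12G G Q P R cc).trans (klEngU₀12G_le_klEngU₀10 G P R cc)

/-- `klEngU₀12GQ ≤ klEngU₀4` (the link every (c)-closer U-door reads, e.g. p2's never-binding `hshift_door_klHshiftC_of_le_klEngU₀4`, pen (R281)(S2)). -/
theorem klEngU₀12GQ_le_klEngU₀4 : klEngU₀12GQ G Q P R cc ≤ klEngU₀4 P R cc := (klEngU₀12GQ_le_klEngU₀10 G Q P R cc).trans (klEngU₀10_le_klEngU₀4 P R cc)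

/-- `klEngU₀12GQ ≤ klE5FrU G R`. -/
theorem klEngU₀12GQ_le_klE5FrU : klEngU₀12GQ G Q P R cc ≤ klE5FrU G R := (klEngU₀12GQ_le_klEngU₀12G G Q P R cc).trans (klEngU₀12G_le_klE5FrU G P R cc)

/-- `klEngU₀12GQ ≤ klTwoLegMomU R (klZtG G P R) (klZs2G G P R)` (the (e) closer's `hUm`). -/
theorem klEngU₀12GQ_le_klTwoLegMomU : klEngU₀12GQ G Q P R cc ≤ klTwoLegMomU R (klZtG G P R) (klZs2G G P R) :=
  (klEngU₀12GQ_le_klEngU₀12G G Q P R cc).trans (klEngU₀12G_le_klTwoLegMomU G P R cc)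

/-- `klEngU₀12GQ ≤ 1/(64·(|klZs2G G P R|+1))`. -/
theorem klEngU₀12GQ_le_inv_klZs2G : klEngU₀12GQ G Q P R cc ≤ 1 / (64 * (|klZs2G G P R| + 1)) :=
  (klEngU₀12GQ_le_klEngU₀12G G Q P R cc).trans (klEngU₀12G_le_inv_klZs2G G P R cc)

/-- `klEngU₀12GQ ≤ R.cz/(1200·(klZs1G G P R+1))`. -/
theorem klEngU₀12GQ_le_cz_klZs1G : klEngU₀12GQ G Q P R cc ≤ R.cz / (1200 * (klZs1G G P R + 1)) :=
  (klEngU₀12GQ_le_klEngU₀12G G Q P R cc).trans (klEngU₀12G_le_cz_klZs1G G P R cc)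

/-- `klEngU₀12GQ ≤ 1/(20·(klZs1G G P R+1))`. -/
theorem klEngU₀12GQ_le_inv_klZs1G : klEngU₀12GQ G Q P R cc ≤ 1 / (20 * (klZs1G G P R + 1)) :=
  (klEngU₀12GQ_le_klEngU₀12G G Q P R cc).trans (klEngU₀12G_le_inv_klZs1G G P R cc)

/-- `klEngU₀12GQ ≤ klTSU R`. -/
theorem klEngU₀12GQ_le_klTSU : klEngU₀12GQ G Q P R cc ≤ klTSU R := (klEngU₀12GQ_le_klEngU₀12G G Q P R cc).trans (klEngU₀12G_le_klTSU G P R cc)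

/-- `klEngU₀12GQ ≤ klLastRespU P R`. -/
theorem klEngU₀12GQ_le_klLastRespU : klEngU₀12GQ G Q P R cc ≤ klLastRespU P R :=
  (klEngU₀12GQ_le_klEngU₀12G G Q P R cc).trans (klEngU₀12G_le_klLastRespU G P R cc)

/-- `klEngU₀12GQ ≤ klGridU₀ R`. -/
theorem klEngU₀12GQ_le_klGridU₀ : klEngU₀12GQ G Q P R cc ≤ klGridU₀ R := (klEngU₀12GQ_le_klEngU₀12G G Q P R cc).trans (klEngU₀12G_le_klGridU₀ G P R cc)

/-- `klEngU₀12GQ ≤ 1/(klReadOscC P R + 1)`. -/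
theorem klEngU₀12GQ_le_inv_klReadOscC : klEngU₀12GQ G Q P R cc ≤ 1 / (klReadOscC P R + 1) :=
  (klEngU₀12GQ_le_klEngU₀12G G Q P R cc).trans (klEngU₀12G_le_inv_klReadOscC G P R cc)

/-- `klEngU₀12GQ ≤ klTailBookU`. -/
theorem klEngU₀12GQ_le_klTailBookU : klEngU₀12GQ G Q P R cc ≤ klTailBookU := (klEngU₀12GQ_le_klEngU₀12G G Q P R cc).trans (klEngU₀12G_le_klTailBookU G P R cc)

/-- `klEngU₀12GQ ≤ klE5uM P R` (class #6 fit input, Q-free). -/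
theorem klEngU₀12GQ_le_klE5uM : klEngU₀12GQ G Q P R cc ≤ klE5uM P R := (klEngU₀12GQ_le_klEngU₀12G G Q P R cc).trans (klEngU₀12G_le_klE5uM G P R cc)

/-- `klEngU₀12GQ ≤ klEngU₀9` (v1 door). -/
theorem klEngU₀12GQ_le_klEngU₀9 : klEngU₀12GQ G Q P R cc ≤ klEngU₀9 P R cc := (klEngU₀12GQ_le_klEngU₀12G G Q P R cc).trans (klEngU₀12G_le_klEngU₀9 G P R cc)

/-- `klEngU₀12GQ ≤ klEngU₀3`. -/
theorem klEngU₀12GQ_le_klEngU₀3 : klEngU₀12GQ G Q P R cc ≤ klEngU₀3 P R cc := (klEngU₀12GQ_le_klEngU₀12G G Q P R cc).trans (klEngU₀12G_le_klEngU₀3 G P R cc)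

variable {G R}

/-- **`0 < klEngU₀12GQ G Q P R cc`** under `G.WF`, `P.WF`, `R.WF2`, `0 ≤ Q.CR` (every Q-keyed entry is positive at EVERY `Q` with `0 ≤ Q.CR`; the image's witness line reads `klEngU₀12GQ_pos Q P c hG hP hR hQ`). -/
theorem klEngU₀12GQ_pos (hG : G.WF) (hP : P.WF) (hR : R.WF2) (hQ : 0 ≤ Q.CR) : 0 < klEngU₀12GQ G Q P R cc :=
  lt_min (klEngU₀12G_pos P cc hG hP hR)
    (lt_min (klCUu2_pos P R _ Q cc)
      (lt_min (klE5ShareU2_pos P R Q cc)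
        (lt_min (klTowerU_pos P R Q cc)
          (lt_min (klTowerUC_pos P R Q cc)
            (lt_min (klIsoMomU_pos _ P R _ cc)
              (lt_min (klE4UF_pos _ P R _ cc)
                (lt_min (klCTu7_pos P R _ _ _ _ cc)
                  (lt_min (klE5RowsUG_pos _ P _)
                    (lt_min (klZspU5_pos P R _ _ _ cc)
                      (lt_min (klGridLitUAtG_pos G P R _ cc) (lt_min (klTowerCoreUCG_pos G P R _ cc)
                        (lt_min (klCTu8T_pos P R _ _ _ _ cc) (lt_min (klZspU5Z_pos P R _ _ _ cc) (klValU_pos hP hQ))))))))))))))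

end Projections

/-! ## §2 Token #28 at `G` with the UNCAPPED core's c-threshold: `klEngC₃7GU G P R` -/

section TokenC3U

variable (G : GeoConsts) (P : SplitConsts) (R : RenConsts)

/-- **`klEngC₃7GU G P R := klEngC₃7G G P R ⊓ klTowerCoreCCG G P R`** — D2G's token #28 at `G` with the UNCAPPED core-C package's regime-constant threshold appended
(the (α1) (b) closer reads `towerCoreCG_at`'s `hcT` from it). -/
def klEngC₃7GU : ℝ := min (klEngC₃7G G P R) (klTowerCoreCCG G P R)

/-- `klEngC₃7GU ≤ klEngC₃7G` — every D2G c-door is kept. -/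
theorem klEngC₃7GU_le_klEngC₃7G : klEngC₃7GU G P R ≤ klEngC₃7G G P R := min_le_left _ _

/-- `klEngC₃7GU ≤ klTowerCoreCCG G P R` (the uncapped core's c-slot). -/
theorem klEngC₃7GU_le_klTowerCoreCCG : klEngC₃7GU G P R ≤ klTowerCoreCCG G P R := min_le_right _ _

/-- THE #28 LIFT LINE: `klEngC₃7GU ≤ klEngC₃6` (the image's `hc36`). -/
theorem klEngC₃7GU_le_klEngC₃6 : klEngC₃7GU G P R ≤ klEngC₃6 P R := (klEngC₃7GU_le_klEngC₃7G G P R).trans (klEngC₃7G_le_klEngC₃6 G P R)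

/-- `klEngC₃7GU ≤ R.cz·ln 4/(1200·(klZs1G G P R + 1))`. -/
theorem klEngC₃7GU_le_cz_row : klEngC₃7GU G P R ≤ R.cz * Real.log 4 / (1200 * (klZs1G G P R + 1)) :=
  (klEngC₃7GU_le_klEngC₃7G G P R).trans (klEngC₃7G_le_cz_row G P R)

/-- `klEngC₃7GU ≤ ln 4/(20·(klZs1G G P R + 1))`. -/
theorem klEngC₃7GU_le_log_row : klEngC₃7GU G P R ≤ Real.log 4 / (20 * (klZs1G G P R + 1)) :=
  (klEngC₃7GU_le_klEngC₃7G G P R).trans (klEngC₃7G_le_log_row G P R)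

/-- `klEngC₃7GU ≤ klTowerCC P R` (D1's full c-slotted tower). -/
theorem klEngC₃7GU_le_klTowerCC : klEngC₃7GU G P R ≤ klTowerCC P R := (klEngC₃7GU_le_klEngC₃7G G P R).trans (klEngC₃7G_le_klTowerCC G P R)

/-- `klEngC₃7GU ≤ klTowerCoreCC9G G P R` (the capped core's c-slot is kept too). -/
theorem klEngC₃7GU_le_klTowerCoreCC9G : klEngC₃7GU G P R ≤ klTowerCoreCC9G G P R :=
  (klEngC₃7GU_le_klEngC₃7G G P R).trans (klEngC₃7G_le_klTowerCoreCC9G G P R)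

/-- `klEngC₃7GU ≤ klGridLitCAtG G P R` (the grid producer's c-threshold; the (b) closer's `hcG`). -/
theorem klEngC₃7GU_le_klGridLitCAtG : klEngC₃7GU G P R ≤ klGridLitCAtG G P R := (klEngC₃7GU_le_klEngC₃7G G P R).trans (klEngC₃7G_le_klGridLitCAtG G P R)

variable {R}

/-- `0 < klEngC₃7GU G P R` under `R.WF2` (a `(G, Q')`-keyed image's witness line reads `klEngC₃7GU_pos G P hR`). -/
theorem klEngC₃7GU_pos (hR : R.WF2) : 0 < klEngC₃7GU G P R := lt_min (klEngC₃7G_pos G P hR) (klTowerCoreCCG_pos G P R)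

end TokenC3U

/-- **THE #28 ROW FROM THE DOORS at `G` (uncapped chain)**: as `klZs1G_mixedRow_of_doors`, from `c ≤ klEngC₃7GU G P R`. -/
theorem klZs1G_mixedRow_of_doorsU {G : GeoConsts} {P : SplitConsts} {R : RenConsts} {c U : ℝ} (hc : c ≤ klEngC₃7GU G P R) (hU : 0 < U) (hU1 : U ≤ 1)
    (hU2 : U ≤ R.cz / (1200 * (klZs1G G P R + 1))) (hU3 : U ≤ 1 / (20 * (klZs1G G P R + 1))) :
    klZs1G G P R * (c / Real.log 4 + U ^ 2) ≤ min (R.cz / 600) (1 / 10) :=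
  klZs1G_mixedRow_of_doors (hc.trans (klEngC₃7GU_le_klEngC₃7G G P R)) hU hU1 hU2 hU3

end Summit.HubbardSuperconductivity.HubbardSuperconductivity.Theorems.EngineV8

end
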